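import Summits.BirchSwinnertonDyer.BirchSwinnertonDyer.Theorems.PrintCf2RubinValueTwoKatzMeasureJZeroSeamValuesAtLevel
import Summits.BirchSwinnertonDyer.BirchSwinnertonDyer.Theorems.PrintCf2RubinValueTwoKatzMeasureJZeroSeamReferenceBlock
import Summits.BirchSwinnertonDyer.BirchSwinnertonDyer.Theorems.PrintCf2RubinValueTwoKatzMeasureJZeroSeamValuesOfLabelData
import Summits.BirchSwinnertonDyer.BirchSwinnertonDyer.Theorems.PrintCf2RubinValueTwoKatzMeasureJZeroSeamIntegralityOracles
import Summits.BirchSwinnertonDyer.BirchSwinnertonDyer.Theorems.PrintCf2RubinValueTwoKatzMeasureJZeroSeamModelGrossencharacter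
import Summits.BirchSwinnertonDyer.BirchSwinnertonDyer.Theorems.PrintCf2RubinValueTwoKatzMeasureJZeroSeamFrameLTDatum
import Summits.BirchSwinnertonDyer.BirchSwinnertonDyer.Theorems.PrintCf2RubinValueTwoKatzMeasureJZeroSeamClassSumAtLevel
import Summits.BirchSwinnertonDyer.BirchSwinnertonDyer.Theorems.PrintCf2RubinValueTwoKatzMeasureJZeroFrameSevenConjugate
import Summits.BirchSwinnertonDyer.BirchSwinnertonDyer.Theorems.PrintCf2RubinValueTwoKatzMeasureJZeroReadingConjugacy
import Literature.NumberTheory.NumberFields.RayClassFieldArtinSymbolSurjective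
import Literature.NumberTheory.EllipticCurves.DivisionPointsOnLaneCurve
import Literature.NumberTheory.ComplexMultiplication.EllipticUnits.GrossencharacterReciprocity
import HarnessLib

/-!
# [I2] THE PER-UNIT VALUES OF THE `j = 0` SEAM ON THE LANE — `perUnitValues_of_lane` (FILE-4 of the bridge `P1_of_lane`)

Cell `bsd-print-cf2`, LEAD seat `bsd-line-cf2-p1` g20, crux `stmt-BirchSwinnertonDyer-20368` (`PrintCf2.SplitBadTwoRankOneOfFacts`),
registered skeleton v14.10 of the line `yager_twist_dictionary`; BRIDGE stub `stub_perLevelBridge_two` (= `P1`, the per-level twisted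
class-sum identity of de Shalit's measure at `p = 2`, `h_K = 1`, `j = 0`).  `--supports` the crux (helper, Theses-free).

★★★ `KatzMeasureJZeroSeam.perUnitValues_of_lane (h15 h24ii h24iii h25)` = the hypothesis `hI2` of the landed bridge
`KatzMeasureJZeroTop.P1_of_perUnitValues` (p774994, -w3 g32) VERBATIM ([I2] v2, HOME `bsd-line-cf2-p1-w8/SeamValuesI2_STATEMENT_v2_w8g14.lean`):
for the frame at `v` and de Shalit's reading data `θ, e₂` there are, ONCE AND BEFORE the tame set `S`, a period `Ω = Ω_E ≠ 0` (the Néron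
lattice `Ω_E·w₀(𝓞_K)` of `49a1`), a `τ ∈ Γ_K` (Q-θ), a unit `A₀ ∈ ℤ₂ˣ` and the Grössencharacter datum `(𝔣ψ, ψ_K)` (II.1.5, the print
`h15` applied once; `ψ_K(v) = α₀`) such that along every admissible chain of moduli, from level `M₁ = 3` on, the iterated log-derivative
moments of the Coleman power series of the elliptic units `e(𝔞)` at level `𝔪_M`, read through `θ ∘ j_k`, are
`A₀^{k'+1}·ι⁻¹(−12·(N𝔞·E_{k'+1}(ψ(𝔟)Ω; Ω𝔪_M) − E_{k'+1}(ψ(𝔟)Ω; Ω𝔪_M𝔞⁻¹)))` together with the Frobenius twin at `α₀ψ(𝔟)Ω`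
(de Shalit II.4.9–4.10 (26), II.4.14 (38)).

PROOF = ASSEMBLY BY NAME of the lane's landed theorems: the split prime of degree one (`liesOver_ratPlace_of_natCast_mem`,
`ramificationIdx_eq_one_and_inertiaDeg_eq_one_of_natCast_mem_of_ne`, FRAME-7) · the `ℤ₂`-datum (`exists_ltDatum_of_frame`, p775183) · Q-θ
(`exists_absGal_reading_conj_of_split`) · the model lattice and Grössencharacter (`exists_modelLattice_grossencharacter`, p775180) · the three
`𝔓`-integrality oracles and the `A₀`-socket (`hIx_of_lane`, `hIy_of_lane`, `hIu_of_lane`, `exists_padicIntUnit_eq_theta_mul`, p775445,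
cf2c-w4 g17) · the reference reading field (`exists_readingField`, -w8 g14) and reference block (`exists_referenceBlock`, LEAD) · per level
(`M₁ = 3`, `modulusIdeal_insert_le_span_one_sub_pow`, principal generator by `h_K = 1`) -w8 g14's socket `forall_label_moment_eq_at_level`
(FILE-3b) · per label the elliptic unit `ofGlobalUnits (ellipticUnitsGlobal …)` with `isCoprime_chain`, the reading switch `hjC` and `A₀`.
THEOREMS ONLY; CONDITIONAL on the prints II.1.5, II.2.4 (ii)(iii), II.2.5 (i) (hypotheses); nothing is closed; no summit statement is proved
by this seat; BSD is not proved by any of this.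

References: [deShalit1987] E. de Shalit, *Iwasawa theory of elliptic curves with complex multiplication* (1987), II §1.5, II §1.10, II §4.3–4.4,
II §4.7 (16), II §4.9 (i)(ii) (p. 62–63), II §4.10 (26) (p. 64), II §4.12, II §4.14 (38) (p. 71).
-/

set_option linter.dupNamespace false
set_option autoImplicit false

noncomputable section

open scoped Classical
open scoped NumberField nonZeroDivisors
open PowerSeries IsDedekindDomain IsDedekindDomain.HeightOneSpectrum NumberField ValuativeRel Field PeriodPair
open Literature Literature.NumberTheory.NumberFields Literature.NumberTheory.EllipticCurves Literature.NumberTheory.EllipticCurves.DeShalit1987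
  Literature.NumberTheory.EllipticCurves.DivisionPointReadings Literature.NumberTheory.ComplexMultiplication.EllipticUnits
open Literature.NumberTheory.GaloisRepresentations Literature.NumberTheory.GaloisRepresentations.IsNonarchimedeanLocalField
  Literature.NumberTheory.GaloisRepresentations.LubinTate Literature.NumberTheory.EllipticCurves.FormalGroupChart Literature.NumberTheory.PAdicHodge
  Literature.NumberTheory.GaloisRepresentations.ArtinLocalGlobal
  _root_.WeierstrassCurve
open Literature.NumberTheory.LFunctions Literature.NumberTheory.EllipticCurves.GroupDistribution
open Literature.NumberTheory.LFunctions.AbelianDensity (artinSymbol)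
open Literature.NumberTheory.GaloisRepresentations.HeckeCharacter
open Summit.BirchSwinnertonDyer.BirchSwinnertonDyer.Theorems.PrintCf2.EllipticUnitsLocal
  Summit.BirchSwinnertonDyer.BirchSwinnertonDyer.Theorems.PrintCf2.EllipticUnitsGlobal
  Summit.BirchSwinnertonDyer.BirchSwinnertonDyer.Theorems.PrintCf2.EllipticUnitsTwoVariable

namespace Summit.BirchSwinnertonDyer.BirchSwinnertonDyer.Theorems.PrintCf2.KatzMeasureJZeroSeam

attribute [local instance] ltNormUniformSpace ltNormIsUniformAddGroup rk1 nF nE fintypeResidueField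
attribute [local instance] RelNormCoherentUnits.instCommMonoid GlobalNormCoherentUnits.instCommMonoid GlobalNormCoherentUnits.galAction

variable {K : Type} [Field K] [NumberField K]

set_option maxHeartbeats 3200000 in
/-- ★★★ [I2] **The per-unit values of the `j = 0` seam on the lane, at the fixed scale `Ω_E`, with one value constant** — FILE-4 (LEAD g20)
over FILE-3b (-w8 g14), pieces (a) (b) (c), the oracles and the `A₀`-socket (cf2c-w4 g17), Q-θ.
[cite: deShalit1987, II §4.9 (ii) (p. 63), II §4.10 (26) (p. 64), II §4.14 (38) (p. 71)] -/
theorem perUnitValues_of_lane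
    (h15 : DeShalit1987.prop15_grossencharacterReciprocity)
    (_h24ii : DeShalit1987.prop24_ii_galoisAction) (h24iii : DeShalit1987.prop24_iii_unit) (h25 : DeShalit1987.prop25_i_normRelation) :
    ∀ (K : Type) [Field K] [NumberField K] [IsTotallyComplex K]
      (hK : IsImaginaryQuadratic K) (_ : NumberField.classNumber K = 1)
      (ι : PadicAlgCl 2 ≃+* ℂ) (w₀ : InfinitePlace K) (v vbar : HeightOneSpectrum (𝓞 K))
        (hv2 : ((2 : ℕ) : 𝓞 K) ∈ v.asIdeal) (hvbar2 : ((2 : ℕ) : 𝓞 K) ∈ vbar.asIdeal) (hne : vbar ≠ v)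
        (_ : ∀ (w : InfinitePlace K) (k : 𝓞 K), k ∈ v.asIdeal ↔ ‖ι.symm (w.embedding (k : K))‖ < 1)
        {α₀ : 𝓞 K} (hv0 : v.asIdeal = Ideal.span {α₀})
        (hdK : NumberField.discr K = -7) (hα₀ : α₀ ^ 2 - α₀ + 2 = 0)
        (hw2 : ∀ uu : (𝓞 K)ˣ, (uu : 𝓞 K) - 1 ∈ vbar.asIdeal ^ 2 → uu = 1)
    (hq : residueFieldCard (v.adicCompletion K) = 2)
    (h2 : (valuation (v.adicCompletion K)).IsUniformizer ((((2 : ℕ) : 𝒪[v.adicCompletion K]) : v.adicCompletion K)))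
    (u : 𝒪[v.adicCompletion K]ˣ)
    (hu : ((((u : 𝒪[v.adicCompletion K]) * ((2 : ℕ) : 𝒪[v.adicCompletion K]) : 𝒪[v.adicCompletion K]) : v.adicCompletion K)) = ((α₀ : K) : v.adicCompletion K))
    {σ₀ : absoluteGaloisGroup (v.adicCompletion K)} (hσ₀ : IsAbsArithFrob σ₀)
    {ε : (maxUnramifiedCompletion (v.adicCompletion K))ˣ}
    (hε : maxUnramifiedCompletion.galAut (v.adicCompletion K) σ₀ (ε : maxUnramifiedCompletion (v.adicCompletion K)) =
      algebraMap 𝒪[v.adicCompletion K] (maxUnramifiedCompletion (v.adicCompletion K)) (u : 𝒪[v.adicCompletion K]) * (ε : maxUnramifiedCompletion (v.adicCompletion K)))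
    (θ : CompletedAlgClosure (v.adicCompletion K) →+* ℂ_[2])
    (hθ1 : ∀ z : CBall (v.adicCompletion K), ‖θ (z : CompletedAlgClosure (v.adicCompletion K))‖ ≤ 1)
    (e₂ : v.adicCompletionIntegers K ≃+* ℤ_[2])
    (hΘe : ∀ a : 𝒪[v.adicCompletion K], (θ.comp ((CBall (v.adicCompletion K)).subtype.comp
        (algebraMap (UnrCoeff (v.adicCompletion K)) (CBall (v.adicCompletion K))))) (intToUnrCoeff (v.adicCompletion K) a) =
      padicIntCast ℂ_[2] (((e₂ : v.adicCompletionIntegers K →+* ℤ_[2]).comp (integerEquivAdicCompletionIntegers v).toRingHom) a))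
        (_ : Continuous θ)
        (_ : ∀ ζ' : ℂ_[2], (∃ n : ℕ, ζ' ^ 2 ^ n = 1) →
          ∃ ζ : CompletedAlgClosure (v.adicCompletion K), (∃ n : ℕ, ζ ^ 2 ^ n = 1) ∧ θ ζ = ζ')
        (_ : Function.Bijective θ) (_ : ∀ z : CompletedAlgClosure (v.adicCompletion K), ‖z‖ < 1 → ‖θ z‖ < 1),
      ∃ (Ω : ℂ) (τ : absoluteGaloisGroup K) (A₀ : ℤ_[2]ˣ) (𝔣ψ : Ideal (𝓞 K)) (ψK : Ideal (𝓞 K) → 𝓞 K), Ω ≠ 0 ∧ 𝔣ψ ≠ ⊥ ∧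
        (∀ 𝔞 𝔟 : Ideal (𝓞 K), IsCoprime 𝔞 𝔣ψ → IsCoprime 𝔟 𝔣ψ → ψK (𝔞 * 𝔟) = ψK 𝔞 * ψK 𝔟) ∧
        (∀ 𝔞 : Ideal (𝓞 K), IsCoprime 𝔞 𝔣ψ → Ideal.span {ψK 𝔞} = 𝔞) ∧ (∀ α : 𝓞 K, α - 1 ∈ 𝔣ψ → ψK (Ideal.span {α}) = α) ∧
        ψK v.asIdeal = α₀ ∧
      ∀ (S : Finset (HeightOneSpectrum (𝓞 K))), v ∉ S → vbar ∉ S →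
      ∀ (𝔣 : ℕ → Ideal (𝓞 K)) (𝔩 : ℕ → HeightOneSpectrum (𝓞 K)) (𝔪c : ℕ → Ideal (𝓞 K)) (b : ℕ → ℕ)
        (_ : 𝔣 0 = (∏ w ∈ S, w.asIdeal) * vbar.asIdeal ^ 2)
        (h𝔣succ : ∀ k, 𝔣 (k + 1) = 𝔣 k * (𝔩 k).asIdeal) (hdiv : ∀ k, (𝔩 k).asIdeal ∣ 𝔣 k)
        (_ : ∀ k, 𝔣 k = 𝔪c k * vbar.asIdeal ^ (b k + 1)) (_ : ∀ k, 1 ≤ b k)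
        (_ : ∀ k, ¬ 𝔪c k ≤ v.asIdeal) (_ : ∀ k, ¬ 𝔪c k ≤ vbar.asIdeal)
        (_ : ∀ k, 𝔩 k = vbar ∨ 𝔩 k ∈ S)
        (_ : ∀ m : ℕ, ∃ n, 𝔣 n ≤ ((∏ w ∈ S, w.asIdeal) * vbar.asIdeal) ^ m)
    (h𝔣0 : ∀ m : ℕ, 𝔣 m ≠ ⊥) (h𝔣1 : ∀ m : ℕ, 𝔣 m ≠ ⊤)
      (hvm : ∀ m : ℕ, ¬ 𝔣 m ≤ v.asIdeal)
      (hwm : ∀ (m : ℕ) (u : (𝓞 K)ˣ), (u : 𝓞 K) - 1 ∈ 𝔣 m → u = 1)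
      (hle : ∀ m : ℕ, 𝔣 (m + 1) ≤ 𝔣 m)
      (α : ℕ → 𝓞 K) (hα0 : ∀ m, α m ≠ 0) (hα𝔣 : ∀ m, α m - 1 ∈ 𝔣 m)
      (hαw : ∀ (m : ℕ) (w : HeightOneSpectrum (𝓞 K)), w ≠ v → α m ∉ w.asIdeal)
      (f : ℕ → ℕ) (hαπ : ∀ m, ((α m : K) : v.adicCompletion K) =
        ((((u : 𝒪[v.adicCompletion K]) * ((2 : ℕ) : 𝒪[v.adicCompletion K]) : 𝒪[v.adicCompletion K]) : v.adicCompletion K)) ^ f m)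
      (E : ℕ → IntermediateField (v.adicCompletion K) (AlgebraicClosure (v.adicCompletion K)))
      (_ : ∀ m, FiniteDimensional (v.adicCompletion K) (E m)) (_ : ∀ m, IsGalois (v.adicCompletion K) (E m))
      (hE : ∀ m, E m ≤ maxUnramified (v.adicCompletion K))
      (hdegE : ∀ (m : ℕ) (w : WeilGroup (v.adicCompletion K)),
        WeilGroup.toAbsGalois (v.adicCompletion K) w ∈ (E m).fixingSubgroup → (f m : ℤ) ∣ WeilGroup.deg w)
      (hEE : ∀ m, E m ≤ E (m + 1))
      (j : ∀ m : ℕ, unitBall (E m) →+* UnrCoeff (v.adicCompletion K))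
      (_ : ∀ m, (j m).comp (algebraMap (LTCoeff (v.adicCompletion K)) (unitBall (E m))) =
        (intToUnrCoeff (v.adicCompletion K)).comp (LTCoeff.of (v.adicCompletion K)).symm.toRingHom)
      (hjC : ∀ m, (algebraMap (UnrCoeff (v.adicCompletion K)) (CBall (v.adicCompletion K))).comp (j m) = unitBallToCBall (E m))
      (_ : ∀ (m : ℕ) (y : unitBall (E m)), j (m + 1) (inclUnitBall (F := v.adicCompletion K) (hEE m) y) = j m y)
      (ψ : ∀ m n : ℕ, ↥(absRestrictNormalHom (rayClassField K (𝔣 m))).ker ⧸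
        (rayAdicTower (𝔪 := 𝔣 m) (h𝔣0 m) v).U n → ZMod (2 ^ (n + 1)))
      (hψ : ∀ (m n : ℕ) (g : ↥(absRestrictNormalHom (rayClassField K (𝔣 m))).ker),
        g ∈ (rayAdicTower (𝔪 := 𝔣 m) (h𝔣0 m) v).U 0 →
        ψ m n ((rayAdicTower (𝔪 := 𝔣 m) (h𝔣0 m) v).proj n g) =
          PadicInt.toZModPow (n + 1) ((((Units.map (e₂ : v.adicCompletionIntegers K →+* ℤ_[2]).toMonoidHom).comp
            (rayAdicCharacter (h𝔣0 m) (hvm m) (hwm m)))⁻¹ g : ℤ_[2]ˣ) : ℤ_[2]))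
      (g : {c : Ideal (𝓞 K) // c ≠ ⊥ ∧ IsCoprime c (𝔣 0 * v.asIdeal)} → absoluteGaloisGroup K)
      (_ : ∀ (c : {c : Ideal (𝓞 K) // c ≠ ⊥ ∧ IsCoprime c (𝔣 0 * v.asIdeal)}) (m k : ℕ),
        absRestrictNormalHom (rayClassField K (𝔣 m * v.asIdeal ^ (k + 1))) (g c) =
          artinSymbol (galFrob K (rayClassField K (𝔣 m * v.asIdeal ^ (k + 1)))) c.1)
      (x : ∀ (_ : {c : Ideal (𝓞 K) // c ≠ ⊥ ∧ IsCoprime c (𝔣 0 * v.asIdeal)}) (m k : ℕ),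
        rayClassField K (𝔣 m * v.asIdeal ^ (k + 1)))
      (hx : ∀ (c : {c : Ideal (𝓞 K) // c ≠ ⊥ ∧ IsCoprime c (𝔣 0 * v.asIdeal)}) (m k : ℕ),
        IsThetaValueOne w₀.embedding (𝔣 m * v.asIdeal ^ (k + 1)) c.1
          (algClosureEmb w₀.embedding ((x c m k : rayClassField K (𝔣 m * v.asIdeal ^ (k + 1))) : AlgebraicClosure K)))
      (_ : ∀ m n, ((rayAdicTower (𝔪 := 𝔣 m) (h𝔣0 m) v).U n).Normal)
      (_ : ∀ m n, ((absRayAdicTower (𝔪' := 𝔣 m) (h𝔣0 m) v).U n).Normal)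
      (μ : GroupDistribution (SubgroupTower.diagonal (fun m ↦ absRayAdicTower (𝔪' := 𝔣 m) (h𝔣0 m) v)
        (fun m n ↦ absRayAdicTower_U_anti (h𝔣0 m) (h𝔣0 (m + 1)) v (hle m) n)) ℂ_[2]),
      μ.bound = 1 →
      (∀ (c : {c : Ideal (𝓞 K) // c ≠ ⊥ ∧ IsCoprime c (𝔣 0 * v.asIdeal)}) (n : ℕ)
        (b : absoluteGaloisGroup K ⧸ (absRayAdicTower (𝔪' := 𝔣 n) (h𝔣0 n) v).U n),
        (twisting (g c) (Ideal.absNorm c.1 : ℂ_[2]) μ).μ n b =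
        (GroupDistribution.induceFrom (Γ := absoluteGaloisGroup K)
          (fun k ↦ rayAdicTower_U_eq_subgroupOf (𝔪 := 𝔣 n) (h𝔣0 n) v k)
          (fun b : GlobalNormCoherentUnits (h𝔣0 n) v ↦
            localMeasureFamily (h𝔣0 n) (hvm n) (hwm n) hq h2 u (E n) (hE n) hσ₀ hε θ hθ1 (j n) (hjC n) e₂ (ψ n) (hψ n)
              (RelNormCoherentUnits.ofGlobalUnits (h𝔣0 n) (hvm n) (hwm n) (isUniformizer_unit_mul h2 u) (hα0 n) (hα𝔣 n) (hαw n)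
                (hαπ n) (E n) (hE n) (hdegE n) b))
          zero_le_one (fun _ ↦ le_rfl)
          (ellipticUnitsGlobal h24iii h25 hK w₀.embedding (h𝔣0 n) (h𝔣1 n) (hvm n) (hwm n) c.2.1 (isCoprime_chain 𝔣 𝔩 h𝔣succ hdiv c.2.2 n)
            (x c n) (hx c n))).μ n b) →
      ∃ M₁ : ℕ, ∀ (k : ℕ) (M : ℕ), M₁ ≤ M → 𝔣 k = modulusIdeal (insert vbar S) (fun _ ↦ M) →
        ∃ (𝔟 : Ideal (𝓞 K)) (LM : PeriodPair) (Lat : Ideal (𝓞 K) → PeriodPair),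
          IsCoprime 𝔟 (𝔣ψ * modulusIdeal (insert vbar S) (fun _ ↦ M) * v.asIdeal) ∧
          absRestrictNormalHom (rayClassField K (𝔣ψ * modulusIdeal (insert vbar S) (fun _ ↦ M) * v.asIdeal)) τ⁻¹ =
            artinSymbol (galFrob K (rayClassField K (𝔣ψ * modulusIdeal (insert vbar S) (fun _ ↦ M) * v.asIdeal))) 𝔟 ∧
          (∀ z : ℂ, z ∈ LM.lattice ↔
            ∃ y ∈ ((modulusIdeal (insert vbar S) (fun _ ↦ M) : Ideal (𝓞 K)) : FractionalIdeal (𝓞 K)⁰ K), z = Ω * w₀.embedding y) ∧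
          (∀ 𝔟 : Ideal (𝓞 K), 𝔟 ≠ ⊥ → ∀ z : ℂ, z ∈ (Lat 𝔟).lattice ↔
            ∃ y ∈ ((modulusIdeal (insert vbar S) (fun _ ↦ M) : FractionalIdeal (𝓞 K)⁰ K) / (𝔟 : FractionalIdeal (𝓞 K)⁰ K)),
              z = Ω * w₀.embedding y) ∧
          ∀ (i : {c : Ideal (𝓞 K) // c ≠ ⊥ ∧ IsCoprime c (𝔣 0 * v.asIdeal)}) (k' : ℕ), (θ.comp ((CBall (v.adicCompletion K)).subtype.comp (algebraMap (UnrCoeff (v.adicCompletion K)) (CBall (v.adicCompletion K))))) (j k (PowerSeries.constantCoeff ((fun g' : PowerSeries (unitBall (E k)) =>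
          (invDiff (isLTRing_LTCoeff (isUniformizer_unit_mul h2 u)) (isLTSeries_LTCoeff ((u : 𝒪[v.adicCompletion K]) * ((2 : ℕ) : 𝒪[v.adicCompletion K])))).map (algebraMap (LTCoeff (v.adicCompletion K)) (unitBall (E k))) * PowerSeries.derivative (unitBall (E k)) g')^[k']
          (relLogDerivSeries (isUniformizer_unit_mul h2 u) (E k) hq (hE k) hσ₀ (RelNormCoherentUnits.ofGlobalUnits (h𝔣0 k) (hvm k) (hwm k) (isUniformizer_unit_mul h2 u) (hα0 k) (hα𝔣 k) (hαw k) (hαπ k) (E k) (hE k) (hdegE k)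
          (ellipticUnitsGlobal h24iii h25 hK w₀.embedding (h𝔣0 k) (h𝔣1 k) (hvm k) (hwm k) i.2.1 (isCoprime_chain 𝔣 𝔩 h𝔣succ hdiv i.2.2 k) (x i k) (hx i k))))))) = (padicIntCast ℂ_[2] ((A₀ : ℤ_[2]ˣ) : ℤ_[2])) ^ (k' + 1) * ((ι.symm (-12 * (((Ideal.absNorm i.1 : ℕ) : ℂ) * LM.eisensteinE (k' + 1) (w₀.embedding ((ψK 𝔟 : 𝓞 K) : K) * Ω) - (Lat i.1).eisensteinE (k' + 1) (w₀.embedding ((ψK 𝔟 : 𝓞 K) : K) * Ω))) :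
          PadicAlgCl 2) : ℂ_[2]) ∧ (θ.comp ((CBall (v.adicCompletion K)).subtype.comp (algebraMap (UnrCoeff (v.adicCompletion K)) (CBall (v.adicCompletion K))))) (j k ((frobUnitBall (E k) σ₀ : unitBall (E k) →+* unitBall (E k)) (PowerSeries.constantCoeff ((fun g' : PowerSeries (unitBall (E k)) =>
          (invDiff (isLTRing_LTCoeff (isUniformizer_unit_mul h2 u)) (isLTSeries_LTCoeff ((u : 𝒪[v.adicCompletion K]) * ((2 : ℕ) : 𝒪[v.adicCompletion K])))).map (algebraMap (LTCoeff (v.adicCompletion K)) (unitBall (E k))) * PowerSeries.derivative (unitBall (E k)) g')^[k']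
          (relLogDerivSeries (isUniformizer_unit_mul h2 u) (E k) hq (hE k) hσ₀ (RelNormCoherentUnits.ofGlobalUnits (h𝔣0 k) (hvm k) (hwm k) (isUniformizer_unit_mul h2 u) (hα0 k) (hα𝔣 k) (hαw k) (hαπ k) (E k) (hE k) (hdegE k)
          (ellipticUnitsGlobal h24iii h25 hK w₀.embedding (h𝔣0 k) (h𝔣1 k) (hvm k) (hwm k) i.2.1 (isCoprime_chain 𝔣 𝔩 h𝔣succ hdiv i.2.2 k) (x i k) (hx i k)))))))) = (padicIntCast ℂ_[2] ((A₀ : ℤ_[2]ˣ) : ℤ_[2])) ^ (k' + 1) *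
          ((ι.symm (-12 * (((Ideal.absNorm i.1 : ℕ) : ℂ) * LM.eisensteinE (k' + 1) (w₀.embedding ((α₀ : 𝓞 K) : K) * (w₀.embedding ((ψK 𝔟 : 𝓞 K) : K) * Ω)) - (Lat i.1).eisensteinE (k' + 1) (w₀.embedding ((α₀ : 𝓞 K) : K) * (w₀.embedding ((ψK 𝔟 : 𝓞 K) : K) * Ω)))) : PadicAlgCl 2) : ℂ_[2]) := by
  intro K _ _ _ hK hh ι w₀ v vbar hv2 hvbar2 hne hιv α₀ hv0 hdK hα₀ hw2 hq h2 u hu σ₀ hσ₀ ε hε θ hθ1 e₂ hΘe hθc hθζ hθb hθlt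
  classical
  haveI : CharZero (v.adicCompletion K) := charZero_of_injective_algebraMap (algebraMap K (v.adicCompletion K)).injective
  -- ### §0 the split prime `v ∣ 2` of degree one
  haveI := liesOver_ratPlace_of_natCast_mem K v hv2
  obtain ⟨he, hf⟩ := ramificationIdx_eq_one_and_inertiaDeg_eq_one_of_natCast_mem_of_ne K hK.1 hv2 hvbar2 hne
  have hprime₁ : Prime (1 - α₀) := KatzMeasureJZeroTop.prime_one_sub_of_generator hK hv2 hvbar2 hne hv0 hα₀
  -- ### §1 the lane's `ℤ₂`-datum (piece (a))
  obtain ⟨c, ϖ, P, hA, hPlt, hPexp, heπ, hc, hV, hp, hϖ⟩ := exists_ltDatum_of_frame v he hf hα₀ u hu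
  -- ### §2 Q-θ: the `τ_K` conjugating the `2`-adic and the complex readings
  obtain ⟨τK, hτK⟩ := KatzMeasureJZeroTop.exists_absGal_reading_conj_of_split (p := 2) hK.1 hv2 hvbar2 hne θ e₂ hΘe ι w₀ hιv
  -- ### §3 the model lattice with its Grössencharacter (piece (b); the fifth print, once)
  obtain ⟨L, ΩE, 𝔣ψ, ψK, hLE, hΩE, h₂, h₃, h𝔣ψ0, hv𝔣ψ, hψmul, hψspan, hψone, hψv, h6, h7⟩ :=
    exists_modelLattice_grossencharacter h15 hK hdK w₀ hv2 hv0 hα₀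
  have hw : w₀.embedding (α₀ : K) ^ 2 = w₀.embedding (α₀ : K) - 2 := by
    have h1 : ((α₀ : K)) ^ 2 - (α₀ : K) + 2 = 0 := by
      have := congrArg ((↑) : 𝓞 K → K) hα₀
      push_cast at this
      exact this
    have h2' := congrArg w₀.embedding h1
    simp only [map_add, map_sub, map_pow, map_ofNat, map_zero] at h2'
    linear_combination h2'
  -- ### §4 the three `𝔓`-integrality oracles (cf2c-w4 g17)
  have hIx :  ∀ (𝔠 : Ideal (𝓞 K)), 𝔠 ≠ ⊥ → ¬ 𝔠 ≤ v.asIdeal → ∀ z : ℂ, z ∈ idealInvLattice w₀.embedding 𝔠 L.lattice → z ∉ L.lattice →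
      ∀ {𝔐 : Ideal (𝓞 K)} (F : IntermediateField (v.adicCompletion K) (AlgebraicClosure (v.adicCompletion K)))
        [FiniteDimensional (v.adicCompletion K) F]
        (hF : ∀ y : AlgebraicClosure K, y ∈ rayClassField K 𝔐 → absClosureEmbedding K (v.adicCompletion K) y ∈ F) (X : rayClassField K 𝔐),
        algClosureEmb w₀.embedding X = ℘[L] z - (((⟨1, -1, 0, -2, -1⟩ : WeierstrassCurve ℤ)).baseChange ℂ).b₂ / 12 → X ∈ readingRing F hF :=
    hIx_of_lane w₀.embedding L hLE h₂ h₃ hv0 hw h2 u hu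
  have hIy :  ∀ (𝔠 : Ideal (𝓞 K)), 𝔠 ≠ ⊥ → ¬ 𝔠 ≤ v.asIdeal → ∀ z : ℂ, z ∈ idealInvLattice w₀.embedding 𝔠 L.lattice → z ∉ L.lattice →
      ∀ {𝔐 : Ideal (𝓞 K)} (F : IntermediateField (v.adicCompletion K) (AlgebraicClosure (v.adicCompletion K)))
        [FiniteDimensional (v.adicCompletion K) F]
        (hF : ∀ y : AlgebraicClosure K, y ∈ rayClassField K 𝔐 → absClosureEmbedding K (v.adicCompletion K) y ∈ F) (Y : rayClassField K 𝔐),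
        algClosureEmb w₀.embedding Y = (℘'[L] z - (((⟨1, -1, 0, -2, -1⟩ : WeierstrassCurve ℤ)).baseChange ℂ).a₁ *
          (℘[L] z - (((⟨1, -1, 0, -2, -1⟩ : WeierstrassCurve ℤ)).baseChange ℂ).b₂ / 12) - (((⟨1, -1, 0, -2, -1⟩ : WeierstrassCurve ℤ)).baseChange ℂ).a₃) / 2 →
        Y ∈ readingRing F hF :=
    hIy_of_lane w₀.embedding L hLE h₂ h₃ hv0 hw h2 u hu h𝔣ψ0 hv𝔣ψ h6
  have hIu :  ∀ (𝔠 : Ideal (𝓞 K)), 𝔠 ≠ ⊥ → ¬ 𝔠 ≤ v.asIdeal → ∀ z₁ z₂ : ℂ, z₁ ∈ idealInvLattice w₀.embedding 𝔠 L.lattice →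
      z₂ ∈ idealInvLattice w₀.embedding 𝔠 L.lattice → z₁ ∉ L.lattice → z₂ ∉ L.lattice → z₁ - z₂ ∉ L.lattice → z₁ + z₂ ∉ L.lattice →
      ∀ {𝔐 : Ideal (𝓞 K)} (F : IntermediateField (v.adicCompletion K) (AlgebraicClosure (v.adicCompletion K)))
        [FiniteDimensional (v.adicCompletion K) F]
        (hF : ∀ y : AlgebraicClosure K, y ∈ rayClassField K 𝔐 → absClosureEmbedding K (v.adicCompletion K) y ∈ F) (X₁ X₂ : rayClassField K 𝔐),
        algClosureEmb w₀.embedding X₁ = ℘[L] z₁ - (((⟨1, -1, 0, -2, -1⟩ : WeierstrassCurve ℤ)).baseChange ℂ).b₂ / 12 →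
        algClosureEmb w₀.embedding X₂ = ℘[L] z₂ - (((⟨1, -1, 0, -2, -1⟩ : WeierstrassCurve ℤ)).baseChange ℂ).b₂ / 12 →
        ‖(readingFieldHom F hF (X₁ - X₂) : F)‖ = 1 :=
    hIu_of_lane w₀.embedding L hLE h₂ h₃ hv0 hw h2 u hu
      ((integerEquivAdicCompletionIntegers v).trans (padicIntEquivOfDegreeOne K 2 v he hf)) h𝔣ψ0 hv𝔣ψ h6
  -- ### §5 the reference reading field `E₀ ⊇ e(K(𝔣ψ·(1 − α₀)³))` with its `α`-datum (-w8 g14 `exists_readingField`)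
  have hπ₁v : (1 - α₀ : 𝓞 K) ∉ v.asIdeal := fun h ↦ by
    have hα₀v : α₀ ∈ v.asIdeal := by rw [hv0]; exact Ideal.mem_span_singleton_self _
    have h1 := v.asIdeal.add_mem hα₀v h
    rw [KatzMeasureJZeroTop.generator_add_one_sub] at h1
    exact v.isPrime.ne_top ((Ideal.eq_top_iff_one _).mpr h1)
  have h𝔪0 : Ideal.span {((1 - α₀) ^ 3 : 𝓞 K)} ≠ ⊥ := by
    rw [Ne, Ideal.span_singleton_eq_bot]; exact pow_ne_zero _ hprime₁.ne_zero
  have hv𝔪 : ¬ Ideal.span {((1 - α₀) ^ 3 : 𝓞 K)} ≤ v.asIdeal := fun h ↦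
    hπ₁v (v.isPrime.mem_of_pow_mem 3 (h (Ideal.mem_span_singleton_self _)))
  have h𝔑1 : Ideal.span {(1 - α₀ : 𝓞 K)} ≠ ⊥ := by rw [Ne, Ideal.span_singleton_eq_bot]; exact hprime₁.ne_zero
  have hv𝔑1 : ¬ Ideal.span {(1 - α₀ : 𝓞 K)} ≤ v.asIdeal := fun h ↦ hπ₁v (h (Ideal.mem_span_singleton_self _))
  have h𝔐0 : 𝔣ψ * Ideal.span {((1 - α₀) ^ 3 : 𝓞 K)} ≠ ⊥ := mul_ne_zero h𝔣ψ0 h𝔪0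
  have hv𝔐 : ¬ 𝔣ψ * Ideal.span {((1 - α₀) ^ 3 : 𝓞 K)} ≤ v.asIdeal := fun h ↦ (v.isPrime.mul_le.mp h).elim hv𝔣ψ hv𝔪
  have h𝔑0 : 𝔣ψ * (Ideal.span {((1 - α₀) ^ 3 : 𝓞 K)} * Ideal.span {(1 - α₀ : 𝓞 K)}) ≠ ⊥ :=
    mul_ne_zero h𝔣ψ0 (mul_ne_zero h𝔪0 h𝔑1)
  have hv𝔑 : ¬ 𝔣ψ * (Ideal.span {((1 - α₀) ^ 3 : 𝓞 K)} * Ideal.span {(1 - α₀ : 𝓞 K)}) ≤ v.asIdeal := fun h ↦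
    (v.isPrime.mul_le.mp h).elim hv𝔣ψ fun h' ↦ (v.isPrime.mul_le.mp h').elim hv𝔪 hv𝔑1
  obtain ⟨E₀, hfd₀, hgal₀, -, -, hE₀u, hE₀r, f₀, hαf0, hαf𝔑, hαfw, hαfπ, hdegE₀⟩ :=
    exists_readingField (⊥ : IntermediateField (v.adicCompletion K) (AlgebraicClosure (v.adicCompletion K))) ⊥
      bot_le bot_le h𝔐0 hv𝔐 h𝔑0 hv𝔑 hv0 u hu
  haveI := hfd₀
  haveI := hgal₀
  haveI hEll₀ : ∀ m : ℕ, (curveOver (E₀ ⊔ ltField ((u : 𝒪[v.adicCompletion K]) * ((2 : ℕ) : 𝒪[v.adicCompletion K])) m :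
        IntermediateField (v.adicCompletion K) (AlgebraicClosure (v.adicCompletion K)))
      ((((⟨1, -1, 0, -2, -1⟩ : WeierstrassCurve ℤ)).map (Int.castRingHom ℤ_[2])).map ((LTCoeff.of (v.adicCompletion K)).toRingHom.comp
        ((integerEquivAdicCompletionIntegers v).trans (padicIntEquivOfDegreeOne K 2 v he hf)).symm.toRingHom))).IsElliptic := fun m ↦
    isElliptic_curveOver_map_map _ _ _ (by rw [GoldfeldGoodTwists.int49a1_Δ]; norm_num)
  -- ### §6 the reference block (piece (c))
  obtain ⟨βr, xu₀, yu₀, XU₀, YU₀, a₀, hβr, hxu₀, hyu₀, hXU₀, hYU₀, ha₀⟩ :=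
    exists_referenceBlock v he hf hv0 hα₀ hprime₁ hq h2 u hPexp hA hPlt heπ hc hV hp hϖ E₀ hE₀u hσ₀ h𝔣ψ0 hv𝔣ψ hE₀r
      hαf0 hαf𝔑 hαfw hαfπ hdegE₀ θ ι w₀ hτK L hLE hΩE h₂ h₃ ψK hψspan hψv h6 h7 hIx hIy
  -- ### §7 the value constant `A₀ ∈ ℤ₂ˣ` (cf2c-w4 g17's socket)
  obtain ⟨A₀, hA₀⟩ : ∃ A₀ : ℤ_[2]ˣ, padicIntCast ℂ_[2] ((A₀ : ℤ_[2]ˣ) : ℤ_[2]) =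
      θ (algebraMap (v.adicCompletion K) (CompletedAlgClosure (v.adicCompletion K)) ((a₀ : 𝒪[v.adicCompletion K]) : v.adicCompletion K)) *
        algebraMap (PadicAlgCl 2) ℂ_[2] (ι.symm (w₀.embedding (((1 - α₀) ^ 3 : 𝓞 K) : K))) :=
    exists_padicIntUnit_eq_theta_mul he hf hv0 θ ι w₀ hτK e₂ hΘe a₀ 3
  -- ### §8 the level-free output
  refine ⟨ΩE, τK, A₀, 𝔣ψ, ψK, hΩE, h𝔣ψ0, hψmul, hψspan, hψone, hψv, ?_⟩
  intro S hvS hvbS 𝔣 𝔩 𝔪c b h𝔣0eq h𝔣succ hdiv h𝔣eq hb1 h𝔪cv h𝔪cvb h𝔩S hcof h𝔣0 h𝔣1 hvm hwm hle α hα0 hα𝔣 hαw f hαπ E hfdE hgalE hE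
    hdegE hEE j hj hjC hjsucc ψ hψ g hg x hx hUn hUn' μ hμb hμ
  -- ### §9 per level: `M₁ := 3`
  refine ⟨3, fun k M hM h𝔣k ↦ ?_⟩
  haveI := hfdE k
  haveI := hgalE k
  haveI : IsPrincipalIdealRing (𝓞 K) := NumberField.classNumber_eq_one_iff.mp hh
  obtain ⟨μg, hμg⟩ := (IsPrincipalIdealRing.principal (𝔣 k)).principal
  have hμg' : 𝔣 k = Ideal.span {μg} := hμg
  have hμ0 : μg ≠ 0 := fun h ↦ h𝔣0 k (by rw [hμg', h, Ideal.span_singleton_eq_bot])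
  have h𝔪π : 𝔣 k ≤ Ideal.span {((1 - α₀) ^ 3 : 𝓞 K)} := by
    rw [h𝔣k]
    exact KatzMeasureJZeroTop.modulusIdeal_insert_le_span_one_sub_pow hK hv2 hvbar2 hne hv0 hα₀ S (M := M) (n := 3) (by omega)
  -- FILE-3b at the level `𝔪 := 𝔣 k`
  obtain ⟨𝔟, LM, Lat, hcop, hart, hLM, hLat, hlab⟩ :=
    forall_label_moment_eq_at_level hK v he hf hv0 hα₀ hprime₁ hq h2 u hu hPexp hA hPlt heπ hc hV hp hϖ (E k) (hE k) hσ₀ θ ι w₀ hτK hw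
      L hLE hΩE h₂ h₃ ψK h𝔣ψ0 hv𝔣ψ hψmul hψspan hψv h6 h7 hIx hIy hIu E₀ hE₀u hβr xu₀ yu₀ XU₀ YU₀ hxu₀ hyu₀ hXU₀ hYU₀ ha₀
      hμ0 hμg' h𝔪π (hvm k)
  rw [h𝔣k] at hcop hart hLM hLat
  refine ⟨𝔟, LM, Lat, hcop, hart, hLM, hLat, fun i k' ↦ ?_⟩
  -- ### §10 per label: the elliptic unit `e(𝔞_i)` at level `k`, read through `j k`
  obtain ⟨a, ha⟩ := (IsPrincipalIdealRing.principal i.1).principal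
  have ha' : i.1 = Ideal.span {a} := ha
  have ha0 : a ≠ 0 := fun h ↦ i.2.1 (by rw [ha', h, Ideal.span_singleton_eq_bot])
  have eL : ∀ y : unitBall (E k),
      (θ.comp ((CBall (v.adicCompletion K)).subtype.comp (algebraMap (UnrCoeff (v.adicCompletion K)) (CBall (v.adicCompletion K)))))
          (j k y) =
        (θ.comp ((CBall (v.adicCompletion K)).subtype.comp (unitBallToCBall (E k)))) y := fun y ↦ by
    rw [← hjC k]; rfl
  obtain ⟨e1, e2'⟩ := hlab ha0 ha' (isCoprime_chain 𝔣 𝔩 h𝔣succ hdiv i.2.2 k)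
    (RelNormCoherentUnits.ofGlobalUnits (h𝔣0 k) (hvm k) (hwm k) (isUniformizer_unit_mul h2 u) (hα0 k) (hα𝔣 k) (hαw k)
      (hαπ k) (E k) (hE k) (hdegE k)
      (ellipticUnitsGlobal h24iii h25 hK w₀.embedding (h𝔣0 k) (h𝔣1 k) (hvm k) (hwm k) i.2.1 (isCoprime_chain 𝔣 𝔩 h𝔣succ hdiv i.2.2 k)
        (x i k) (hx i k)))
    (x i k) (hx i k) (fun m ↦ rfl) k'
  refine ⟨?_, ?_⟩
  · rw [eL, hA₀]; exact e1
  · rw [eL, hA₀]; exact e2'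

end Summit.BirchSwinnertonDyer.BirchSwinnertonDyer.Theorems.PrintCf2.KatzMeasureJZeroSeam

end
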